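/-
HONEST FRAMING: certified error envelopes and provably optimal rounding/accumulation schemes for
low-precision formats under stated cost models; every table by two implementations; no hardware
or vendor claims.
-/
import Summits.Ventures.CertifiedArithmetic.LowPrec.OptDemotionWitness

/-!
# The demotion law (Theorem T8), part 4: the every-tree witness — `D_t ≥ Q_t` for EVERY tree

OPTIMA.md §B T8(b)(ii) states, with a 837-shape exact-rational certificate, that for every summation
tree `t` the demoted worst case `D_t` is at least opt's coupled tree polynomial `Q_t` (`q ≥ p + 2`,
ties-to-even): a typed witness (types `M`, `Q`, `R` at dyadic scales) makes EVERY wide addition a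
tie resolved downwards and the demotion the tie `2^e(1+u_p) ↦ 2^e`.  THIS FILE makes that half of
Conjecture D a theorem for every tree, in the Jeannerod–Rump model used by parts 1–3:

* `treeQf u t ρ` — ONE two-parameter family carrying opt's three polynomials:
  `M_t = treeM u t`, `Q_t = treeQf u t u_p`, `R_t = treeQf u t w` (`w = u_q/u_p`); the recursion
  `Q(a·b)(ρ) = max(Q_a(ρ) + u M_b, Q_b(ρ) + u M_a, M_a + ρ·Q_b(u/ρ), M_b + ρ·Q_a(u/ρ))`,
  `Q(leaf)(ρ) = 1 + ρ` is opt's `(Q, R)` recursion with `R = Q(u/ρ)` (checked equal to opt's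
  `(M,Q,R)` on all 47 shapes with `n ≤ 8` at six `(q,p)`; here it is the DEFINITION);
* `witD` — the typed witness of `t` at root type `Q` and scale `2^e`;
* `witD_spec` — under the three tie hypotheses on `fl_q` (ties-to-even at the binade points
  `TiesEvenAtPow q`, tie-down at the shifted midpoints `TiesDownAtShift p q` and
  `TiesDownAtShift (q-p) q` — IEEE roundTiesToEven has all three when `q ≥ p + 2`, `p ≥ 2`) every
  subtree of type `X ∈ {M, Q, R}` at scale `2^e` consists of nonnegative floats of `F(q, emin)`,
  COMPUTES `2^e·(1, 1+u_p, 1+w)_X` and SUMS to `2^e·(M_t, Q_t, R_t)_X`;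
* `demotion_tree_witness` — hence with `fl_p` ties-to-even at the binade points the demoted value
  is `2^e` while the exact sum is `2^e · Q_t`: **`s = Q_t · fl_p(ŝ)`, so `D_t ≥ Q_t` for every tree**
  (the upper bound `D_t ≤ Q_t` is proved for chains — part 1 — and for the balanced four-leaf tree
  — part 3, `OptDemotionBalanced`; CONJECTURE D for the rest);
* numbers: `treeQf` gives T5(g)'s `305/256` for the balanced four-leaf tree at `(q,p) = (5,3)` and
  the chain law `1 + u_p + (n-1)u_q` (`treeQf_examples`).
-/

namespace Summit.Ventures.CertifiedArithmetic.LowPrec.Opt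

open Literature.ComputerArithmetic.JeannerodRump2018
open Literature.ComputerArithmetic.JeannerodRump2018.SumTree

/-! ## §1 The one-parameter family of demotion polynomials -/

/-- opt's coupled demotion polynomials as ONE family: `treeQf u t ρ` with `Q_t = treeQf u t u_p`
and `R_t = treeQf u t (u_q/u_p)`. -/
def treeQf (u : ℚ) : SumTree → ℚ → ℚ
  | .leaf _, ρ => 1 + ρ
  | .node a b, ρ =>
      max (max (treeQf u a ρ + u * treeM u b) (treeQf u b ρ + u * treeM u a))
          (max (treeM u a + ρ * treeQf u b (u / ρ)) (treeM u b + ρ * treeQf u a (u / ρ)))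

/-- `treeQf u (leaf x) ρ = 1 + ρ`. -/
@[simp] theorem treeQf_leaf (u x ρ : ℚ) : treeQf u (.leaf x) ρ = 1 + ρ := rfl

/-- The node recursion. -/
theorem treeQf_node (u ρ : ℚ) (a b : SumTree) : treeQf u (.node a b) ρ =
    max (max (treeQf u a ρ + u * treeM u b) (treeQf u b ρ + u * treeM u a))
        (max (treeM u a + ρ * treeQf u b (u / ρ)) (treeM u b + ρ * treeQf u a (u / ρ))) := rfl

/-- NUMBERS: the balanced four-leaf tree at `(q,p) = (5,3)` has `Q = 305/256` (T5(g)'s certified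
value; `= 1 + u_p + 2u_q + u_p u_q`), the three-term chain has `Q = 1 + u_p + 2u_q`, and
`R_pair = treeQf u pair (u/P) = 1 + w + u`. -/
theorem treeQf_examples :
    treeQf (1/32) (.node (.node (.leaf 0) (.leaf 0)) (.node (.leaf 0) (.leaf 0))) (1/8)
      = 305 / 256 ∧
    treeQf (1/32) (.node (.node (.leaf 0) (.leaf 0)) (.leaf 0)) (1/8) = 1 + 1/8 + 2 * (1/32) ∧
    treeQf (1/32) (.node (.leaf 0) (.leaf 0)) ((1/32) / (1/8)) = 1 + 1/4 + 1/32 := by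
  refine ⟨?_, ?_, ?_⟩ <;> norm_num [treeQf_node, treeQf_leaf, treeM]

/-! ## §2 The typed witness -/

/-- The three types of opt's witness: a subtree of type `M`/`Q`/`R` at scale `σ` computes
`σ`, `σ(1+u_p)`, `σ(1+w)`. -/
inductive DTy
  | M
  | Q
  | R
  deriving DecidableEq

/-- The value computed by a subtree of type `X` at scale `2^e`. -/
def dval (P w : ℚ) : DTy → ℤ → ℚ
  | .M, e => (2 : ℚ) ^ e
  | .Q, e => (2 : ℚ) ^ e + (2 : ℚ) ^ e * P
  | .R, e => (2 : ℚ) ^ e + (2 : ℚ) ^ e * w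

/-- The polynomial of type `X`: `M_t`, `Q_t = treeQf u t P`, `R_t = treeQf u t w`. -/
def dpoly (u P w : ℚ) : DTy → SumTree → ℚ
  | .M, t => treeM u t
  | .Q, t => treeQf u t P
  | .R, t => treeQf u t w

/-- THE TYPED WITNESS of `t` (type `X`, scale `2^e`): leaves of type `M/Q/R` are `2^e`,
`2^e(1+u_p)`, `2^e(1+w)`; at a node the option realising the maximum of the recursion decides the
children's types and scales (`u`-child: exponent `e - q`; `P`-child: `e - p`; `w`-child:
`e - (q-p)`), exactly as in OPTIMA T8(b)(ii). -/
def witD (p q : ℕ) (u P w : ℚ) : SumTree → DTy → ℤ → SumTree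
  | .leaf _, X, e => .leaf (dval P w X e)
  | .node a b, .M, e =>
      if treeM u b ≤ treeM u a then .node (witD p q u P w a .M e) (witD p q u P w b .M (e - q))
      else .node (witD p q u P w a .M (e - q)) (witD p q u P w b .M e)
  | .node a b, .Q, e =>
      if treeQf u (.node a b) P = treeQf u a P + u * treeM u b then
        .node (witD p q u P w a .Q e) (witD p q u P w b .M (e - q))
      else if treeQf u (.node a b) P = treeQf u b P + u * treeM u a then
        .node (witD p q u P w a .M (e - q)) (witD p q u P w b .Q e)
      else if treeQf u (.node a b) P = treeM u a + P * treeQf u b (u / P) then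
        .node (witD p q u P w a .M e) (witD p q u P w b .R (e - p))
      else .node (witD p q u P w a .R (e - p)) (witD p q u P w b .M e)
  | .node a b, .R, e =>
      if treeQf u (.node a b) w = treeQf u a w + u * treeM u b then
        .node (witD p q u P w a .R e) (witD p q u P w b .M (e - q))
      else if treeQf u (.node a b) w = treeQf u b w + u * treeM u a then
        .node (witD p q u P w a .M (e - q)) (witD p q u P w b .R e)
      else if treeQf u (.node a b) w = treeM u a + w * treeQf u b (u / w) then
        .node (witD p q u P w a .M e) (witD p q u P w b .Q (e - (q - p : ℕ)))
      else .node (witD p q u P w a .Q (e - (q - p : ℕ))) (witD p q u P w b .M e)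

/-- A maximum of four numbers that is none of the first three is the fourth. -/
theorem max4_eq_last {x y z t : ℚ} (h1 : max (max x y) (max z t) ≠ x)
    (h2 : max (max x y) (max z t) ≠ y) (h3 : max (max x y) (max z t) ≠ z) :
    max (max x y) (max z t) = t := by
  rcases max_choice (max x y) (max z t) with h | h
  · rcases max_choice x y with hxy | hxy
    · exact absurd (h.trans hxy) h1
    · exact absurd (h.trans hxy) h2
  · rcases max_choice z t with hzt | hzt
    · exact absurd (h.trans hzt) h3
    · exact h.trans hzt

/-! ## §3 The witness evaluates as claimed -/

section Spec

variable {p q : ℕ} {emin : ℤ} {flq : ℚ → ℚ}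

/-- `u_p · u_(q-p) = u_q` (`p ≤ q`). -/
theorem unitRoundoff_mul_sub (hpq : p ≤ q) :
    unitRoundoff p * unitRoundoff (q - p) = unitRoundoff q := by
  unfold unitRoundoff
  rw [one_div_mul_one_div, ← pow_add, Nat.add_sub_cancel' hpq]

/-- `u_q / u_p = u_(q-p) = w`. -/
theorem unitRoundoff_div (hpq : p ≤ q) :
    unitRoundoff q / unitRoundoff p = unitRoundoff (q - p) := by
  have hP : unitRoundoff p ≠ 0 := by unfold unitRoundoff; positivity
  rw [div_eq_iff hP, mul_comm, unitRoundoff_mul_sub hpq]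

/-- `u_q / w = u_p`. -/
theorem unitRoundoff_div_sub (hpq : p ≤ q) :
    unitRoundoff q / unitRoundoff (q - p) = unitRoundoff p := by
  have hW : unitRoundoff (q - p) ≠ 0 := by unfold unitRoundoff; positivity
  rw [div_eq_iff hW, ← unitRoundoff_mul_sub hpq]

/-- **THE WITNESS SPECIFICATION.**  Let `u = u_q`, `P = u_p`, `w = u_(q-p)`, `1 ≤ p`, `p + 1 ≤ q`,
and let `fl_q` satisfy the three tie hypotheses.  For every tree `t`, type `X` and exponent `e`
with `emin + q·(height t + 1) ≤ e`: every leaf of `witD t X e` is a nonnegative float of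
`F(q, emin)`, the tree COMPUTES `dval X e = 2^e·(1, 1+P, 1+w)_X` and SUMS to
`2^e · (M_t, Q_t, R_t)_X`. -/
theorem witD_spec (hp : 1 ≤ p) (hpq : p + 1 ≤ q)
    (hM : TiesEvenAtPow q emin flq) (hQ : TiesDownAtShift p q emin flq)
    (hR : TiesDownAtShift (q - p) q emin flq) :
    ∀ (t : SumTree) (X : DTy) (e : ℤ), emin + (q : ℤ) * ((height t : ℤ) + 1) ≤ e →
      (∀ x ∈ leaves (witD p q (unitRoundoff q) (unitRoundoff p) (unitRoundoff (q - p)) t X e),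
          IsFloat q emin x ∧ 0 ≤ x) ∧
      eval flq (witD p q (unitRoundoff q) (unitRoundoff p) (unitRoundoff (q - p)) t X e)
        = dval (unitRoundoff p) (unitRoundoff (q - p)) X e ∧
      exact (witD p q (unitRoundoff q) (unitRoundoff p) (unitRoundoff (q - p)) t X e)
        = (2 : ℚ) ^ e * dpoly (unitRoundoff q) (unitRoundoff p) (unitRoundoff (q - p)) X t := by
  set u := unitRoundoff q with hu
  set P := unitRoundoff p with hP
  set w := unitRoundoff (q - p) with hw
  have h2 : (2 : ℚ) ≠ 0 := by norm_num
  have hPw : P * w = u := by rw [hP, hw, hu]; exact unitRoundoff_mul_sub (by omega)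
  have huP : u / P = w := by rw [hu, hP, hw]; exact unitRoundoff_div (by omega)
  have huw : u / w = P := by rw [hu, hw, hP]; exact unitRoundoff_div_sub (by omega)
  -- scale identities
  have hsq : ∀ e : ℤ, (2 : ℚ) ^ (e - (q : ℤ)) = (2 : ℚ) ^ e * u := fun e => by
    rw [hu]; exact PTree.two_zpow_sub_prec q e
  have hsp : ∀ e : ℤ, (2 : ℚ) ^ (e - (p : ℤ)) = (2 : ℚ) ^ e * P := fun e => by
    rw [hP]; exact PTree.two_zpow_sub_prec p e
  have hsw : ∀ e : ℤ, (2 : ℚ) ^ (e - ((q - p : ℕ) : ℤ)) = (2 : ℚ) ^ e * w := fun e => by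
    rw [hw]; exact PTree.two_zpow_sub_prec (q - p) e
  -- leaves are floats
  have hleafM : ∀ e : ℤ, emin ≤ e → IsFloat q emin ((2 : ℚ) ^ e) := fun e he =>
    PTree.isFloat_two_zpow (by omega) he
  have hleafQ : ∀ e : ℤ, emin + q ≤ e → IsFloat q emin ((2 : ℚ) ^ e + (2 : ℚ) ^ e * P) :=
    fun e he => (witness_isFloat hp hpq he).1.1
  have hleafR : ∀ e : ℤ, emin + q ≤ e → IsFloat q emin ((2 : ℚ) ^ e + (2 : ℚ) ^ e * w) := by
    intro e he
    have := (witness_isFloat (p := q - p) (q := q) (by omega) (by omega) (emin := emin) he).1.1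
    rw [hw]; exact this
  intro t
  induction t with
  | leaf x =>
      intro X e he
      simp only [height_leaf, Nat.cast_zero, zero_add, mul_one] at he
      have he' : emin + q ≤ e := he
      have h2e : (0 : ℚ) ≤ (2 : ℚ) ^ e := (zpow_pos (by norm_num) _).le
      cases X with
      | M =>
          refine ⟨?_, by simp [witD, dval, eval], by simp [witD, dval, exact, dpoly]⟩
          intro x hx; simp only [witD, dval, leaves, List.mem_singleton] at hx; subst hx
          exact ⟨hleafM e (by omega), h2e⟩
      | Q =>
          refine ⟨?_, by simp [witD, dval, eval], by simp [witD, dval, exact, dpoly]; ring⟩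
          intro x hx; simp only [witD, dval, leaves, List.mem_singleton] at hx; subst hx
          exact ⟨hleafQ e he', by have := unitRoundoff_nonneg p; positivity⟩
      | R =>
          refine ⟨?_, by simp [witD, dval, eval], by simp [witD, dval, exact, dpoly]; ring⟩
          intro x hx; simp only [witD, dval, leaves, List.mem_singleton] at hx; subst hx
          exact ⟨hleafR e he', by have := unitRoundoff_nonneg (q - p); positivity⟩
  | node a b iha ihb =>
      intro X e he
      -- exponent bookkeeping for the children
      simp only [height_node, Nat.cast_add, Nat.cast_max, Nat.cast_one] at he
      have hq0 : (0 : ℤ) ≤ q := by omega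
      have hma : ((height a : ℤ) + 1) + 1 ≤ max (height a : ℤ) (height b : ℤ) + 1 + 1 := by
        linarith [le_max_left (height a : ℤ) (height b : ℤ)]
      have hmb : ((height b : ℤ) + 1) + 1 ≤ max (height a : ℤ) (height b : ℤ) + 1 + 1 := by
        linarith [le_max_right (height a : ℤ) (height b : ℤ)]
      have hma' := mul_le_mul_of_nonneg_left hma hq0
      have hmb' := mul_le_mul_of_nonneg_left hmb hq0
      have hha0 : (0 : ℤ) ≤ (q : ℤ) * ((height a : ℤ) + 1) := by positivity
      have hqa : emin + (q : ℤ) * ((height a : ℤ) + 1) ≤ e - q := by nlinarith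
      have hqb : emin + (q : ℤ) * ((height b : ℤ) + 1) ≤ e - q := by nlinarith
      have hea : emin + (q : ℤ) * ((height a : ℤ) + 1) ≤ e := by linarith
      have heb : emin + (q : ℤ) * ((height b : ℤ) + 1) ≤ e := by linarith
      have hpq' : (p : ℤ) ≤ q := by omega
      have hpa : emin + (q : ℤ) * ((height a : ℤ) + 1) ≤ e - p := by linarith
      have hpb : emin + (q : ℤ) * ((height b : ℤ) + 1) ≤ e - p := by linarith
      have hqp' : ((q - p : ℕ) : ℤ) ≤ q := by omega
      have hwa : emin + (q : ℤ) * ((height a : ℤ) + 1) ≤ e - ((q - p : ℕ) : ℤ) := by linarith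
      have hwb : emin + (q : ℤ) * ((height b : ℤ) + 1) ≤ e - ((q - p : ℕ) : ℤ) := by linarith
      have heq : emin + q ≤ e := by nlinarith
      -- generic assembly of a node from the two children specs
      have assemble : ∀ (Xa Xb : DTy) (ea eb : ℤ),
          emin + (q : ℤ) * ((height a : ℤ) + 1) ≤ ea → emin + (q : ℤ) * ((height b : ℤ) + 1) ≤ eb →
          (∀ x ∈ leaves (SumTree.node (witD p q u P w a Xa ea) (witD p q u P w b Xb eb)),
              IsFloat q emin x ∧ 0 ≤ x) ∧
          eval flq (SumTree.node (witD p q u P w a Xa ea) (witD p q u P w b Xb eb))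
            = flq (dval P w Xa ea + dval P w Xb eb) ∧
          exact (SumTree.node (witD p q u P w a Xa ea) (witD p q u P w b Xb eb))
            = (2 : ℚ) ^ ea * dpoly u P w Xa a + (2 : ℚ) ^ eb * dpoly u P w Xb b := by
        intro Xa Xb ea eb hea' heb'
        obtain ⟨la, eva, exa⟩ := iha Xa ea hea'
        obtain ⟨lb, evb, exb⟩ := ihb Xb eb heb'
        refine ⟨?_, by simp only [eval, eva, evb], by simp only [exact, exa, exb]⟩
        intro x hx
        simp only [leaves, List.mem_append] at hx
        rcases hx with hx | hx
        · exact la x hx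
        · exact lb x hx
      cases X with
      | M =>
          by_cases h : treeM u b ≤ treeM u a
          · obtain ⟨l, ev, ex⟩ := assemble .M .M e (e - q) hea hqb
            simp only [witD, if_pos h]
            refine ⟨l, ?_, ?_⟩
            · rw [ev]; simp only [dval]; rw [hsq]; exact hM e (by omega)
            · rw [ex]; simp only [dpoly, treeM_node, max_eq_left h, min_eq_right h]; rw [hsq]; ring
          · have h' : treeM u a ≤ treeM u b := le_of_lt (not_le.mp h)
            obtain ⟨l, ev, ex⟩ := assemble .M .M (e - q) e hqa heb
            simp only [witD, if_neg h]
            refine ⟨l, ?_, ?_⟩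
            · rw [ev]; simp only [dval]; rw [hsq, add_comm]; exact hM e (by omega)
            · rw [ex]; simp only [dpoly, treeM_node, max_eq_right h', min_eq_left h']; rw [hsq]; ring
      | Q =>
          -- the four options of the Q-recursion
          have hrec := treeQf_node u P a b
          rw [huP] at hrec
          by_cases h1 : treeQf u (.node a b) P = treeQf u a P + u * treeM u b
          · obtain ⟨l, ev, ex⟩ := assemble .Q .M e (e - q) hea hqb
            have hW : witD p q u P w (.node a b) .Q e
                = .node (witD p q u P w a .Q e) (witD p q u P w b .M (e - q)) := by
              simp only [witD, if_pos h1]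
            rw [hW]
            refine ⟨l, ?_, ?_⟩
            · rw [ev]; simp only [dval]; rw [hsq]; exact hQ e heq
            · rw [ex]; simp only [dpoly]; rw [h1, hsq]; ring
          by_cases h2 : treeQf u (.node a b) P = treeQf u b P + u * treeM u a
          · obtain ⟨l, ev, ex⟩ := assemble .M .Q (e - q) e hqa heb
            have hW : witD p q u P w (.node a b) .Q e
                = .node (witD p q u P w a .M (e - q)) (witD p q u P w b .Q e) := by
              simp only [witD, if_neg h1, if_pos h2]
            rw [hW]
            refine ⟨l, ?_, ?_⟩
            · rw [ev]; simp only [dval]; rw [hsq]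
              rw [show (2 : ℚ) ^ e * u + ((2 : ℚ) ^ e + (2 : ℚ) ^ e * P)
                  = (2 : ℚ) ^ e + (2 : ℚ) ^ e * P + (2 : ℚ) ^ e * u by ring]
              exact hQ e heq
            · rw [ex]; simp only [dpoly]; rw [h2, hsq]; ring
          by_cases h3 : treeQf u (.node a b) P = treeM u a + P * treeQf u b (u / P)
          · obtain ⟨l, ev, ex⟩ := assemble .M .R e (e - p) hea hpb
            have hW : witD p q u P w (.node a b) .Q e
                = .node (witD p q u P w a .M e) (witD p q u P w b .R (e - p)) := by
              simp only [witD, if_neg h1, if_neg h2, if_pos h3]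
            rw [hW]
            refine ⟨l, ?_, ?_⟩
            · rw [ev]; simp only [dval]; rw [hsp]
              rw [show (2 : ℚ) ^ e + ((2 : ℚ) ^ e * P + (2 : ℚ) ^ e * P * w)
                  = (2 : ℚ) ^ e + (2 : ℚ) ^ e * P + (2 : ℚ) ^ e * (P * w) by ring, hPw]
              exact hQ e heq
            · rw [ex]; simp only [dpoly]; rw [h3, huP, hsp]; ring
          · have h4 : treeQf u (.node a b) P = treeM u b + P * treeQf u a w := by
              rw [huP] at h3; rw [hrec] at h1 h2 h3 ⊢; exact max4_eq_last h1 h2 h3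
            obtain ⟨l, ev, ex⟩ := assemble .R .M (e - p) e hpa heb
            have hW : witD p q u P w (.node a b) .Q e
                = .node (witD p q u P w a .R (e - p)) (witD p q u P w b .M e) := by
              simp only [witD, if_neg h1, if_neg h2, if_neg h3]
            rw [hW]
            refine ⟨l, ?_, ?_⟩
            · rw [ev]; simp only [dval]; rw [hsp]
              rw [show (2 : ℚ) ^ e * P + (2 : ℚ) ^ e * P * w + (2 : ℚ) ^ e
                  = (2 : ℚ) ^ e + (2 : ℚ) ^ e * P + (2 : ℚ) ^ e * (P * w) by ring, hPw]
              exact hQ e heq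
            · rw [ex]; simp only [dpoly]; rw [h4, hsp]; ring
      | R =>
          have hrec := treeQf_node u w a b
          rw [huw] at hrec
          have hRe : flq ((2 : ℚ) ^ e + (2 : ℚ) ^ e * w + (2 : ℚ) ^ e * u) = (2 : ℚ) ^ e + (2 : ℚ) ^ e * w := by
            have := hR e heq; rw [← hw, ← hu] at this; exact this
          by_cases h1 : treeQf u (.node a b) w = treeQf u a w + u * treeM u b
          · obtain ⟨l, ev, ex⟩ := assemble .R .M e (e - q) hea hqb
            have hW : witD p q u P w (.node a b) .R e
                = .node (witD p q u P w a .R e) (witD p q u P w b .M (e - q)) := by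
              simp only [witD, if_pos h1]
            rw [hW]
            refine ⟨l, ?_, ?_⟩
            · rw [ev]; simp only [dval]; rw [hsq]; exact hRe
            · rw [ex]; simp only [dpoly]; rw [h1, hsq]; ring
          by_cases h2 : treeQf u (.node a b) w = treeQf u b w + u * treeM u a
          · obtain ⟨l, ev, ex⟩ := assemble .M .R (e - q) e hqa heb
            have hW : witD p q u P w (.node a b) .R e
                = .node (witD p q u P w a .M (e - q)) (witD p q u P w b .R e) := by
              simp only [witD, if_neg h1, if_pos h2]
            rw [hW]
            refine ⟨l, ?_, ?_⟩
            · rw [ev]; simp only [dval]; rw [hsq]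
              rw [show (2 : ℚ) ^ e * u + ((2 : ℚ) ^ e + (2 : ℚ) ^ e * w)
                  = (2 : ℚ) ^ e + (2 : ℚ) ^ e * w + (2 : ℚ) ^ e * u by ring]
              exact hRe
            · rw [ex]; simp only [dpoly]; rw [h2, hsq]; ring
          by_cases h3 : treeQf u (.node a b) w = treeM u a + w * treeQf u b (u / w)
          · obtain ⟨l, ev, ex⟩ := assemble .M .Q e (e - ((q - p : ℕ) : ℤ)) hea hwb
            have hW : witD p q u P w (.node a b) .R e
                = .node (witD p q u P w a .M e) (witD p q u P w b .Q (e - ((q - p : ℕ) : ℤ))) := by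
              simp only [witD, if_neg h1, if_neg h2, if_pos h3]
            rw [hW]
            refine ⟨l, ?_, ?_⟩
            · rw [ev]; simp only [dval]; rw [hsw]
              rw [show (2 : ℚ) ^ e + ((2 : ℚ) ^ e * w + (2 : ℚ) ^ e * w * P)
                  = (2 : ℚ) ^ e + (2 : ℚ) ^ e * w + (2 : ℚ) ^ e * (P * w) by ring, hPw]
              exact hRe
            · rw [ex]; simp only [dpoly]; rw [h3, huw, hsw]; ring
          · have h4 : treeQf u (.node a b) w = treeM u b + w * treeQf u a P := by
              rw [huw] at h3; rw [hrec] at h1 h2 h3 ⊢; exact max4_eq_last h1 h2 h3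
            obtain ⟨l, ev, ex⟩ := assemble .Q .M (e - ((q - p : ℕ) : ℤ)) e hwa heb
            have hW : witD p q u P w (.node a b) .R e
                = .node (witD p q u P w a .Q (e - ((q - p : ℕ) : ℤ))) (witD p q u P w b .M e) := by
              simp only [witD, if_neg h1, if_neg h2, if_neg h3]
            rw [hW]
            refine ⟨l, ?_, ?_⟩
            · rw [ev]; simp only [dval]; rw [hsw]
              rw [show (2 : ℚ) ^ e * w + (2 : ℚ) ^ e * w * P + (2 : ℚ) ^ e
                  = (2 : ℚ) ^ e + (2 : ℚ) ^ e * w + (2 : ℚ) ^ e * (P * w) by ring, hPw]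
              exact hRe
            · rw [ex]; simp only [dpoly]; rw [h4, hsw]; ring

/-- **`D_t ≥ Q_t` FOR EVERY TREE** (OPTIMA T8(b)(ii), every pair of precisions `p ≥ 1`,
`q ≥ p + 1` at which the tie hypotheses hold — IEEE roundTiesToEven: `p ≥ 2`, `q ≥ p + 2`): for
every tree `t` and scale `2^e` with `emin + q(height t + 1) ≤ e`, the typed witness is a tree of
nonnegative floats of `F(q, emin)` of the SAME SHAPE as `t` whose wide evaluation is `2^e(1+u_p)`,
whose demoted value is `2^e` and whose exact sum is `Q_t · 2^e`:  **`s = Q_t · fl_p(ŝ)`** — the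
constant of Conjecture D is attained, so the exact demoted worst case satisfies `D_t ≥ Q_t`. -/
theorem demotion_tree_witness (hp : 1 ≤ p) (hpq : p + 1 ≤ q) {flp : ℚ → ℚ}
    (hM : TiesEvenAtPow q emin flq)
    (hQ : TiesDownAtShift p q emin flq) (hR : TiesDownAtShift (q - p) q emin flq)
    (hE : TiesEvenAtPow p emin flp) (t : SumTree) {e : ℤ}
    (he : emin + (q : ℤ) * ((height t : ℤ) + 1) ≤ e) :
    (∀ x ∈ leaves (witD p q (unitRoundoff q) (unitRoundoff p) (unitRoundoff (q - p)) t .Q e),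
        IsFloat q emin x ∧ 0 ≤ x) ∧
    eval flq (witD p q (unitRoundoff q) (unitRoundoff p) (unitRoundoff (q - p)) t .Q e)
      = (2 : ℚ) ^ e + (2 : ℚ) ^ e * unitRoundoff p ∧
    flp (eval flq (witD p q (unitRoundoff q) (unitRoundoff p) (unitRoundoff (q - p)) t .Q e))
      = (2 : ℚ) ^ e ∧
    exact (witD p q (unitRoundoff q) (unitRoundoff p) (unitRoundoff (q - p)) t .Q e)
      = treeQf (unitRoundoff q) t (unitRoundoff p)
        * flp (eval flq (witD p q (unitRoundoff q) (unitRoundoff p) (unitRoundoff (q - p)) t .Q e)) := by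
  obtain ⟨l, ev, ex⟩ := witD_spec hp hpq hM hQ hR t .Q e he
  have heq : emin ≤ e := by
    have : (0 : ℤ) ≤ (q : ℤ) * ((height t : ℤ) + 1) := by positivity
    linarith
  have hdem : flp ((2 : ℚ) ^ e + (2 : ℚ) ^ e * unitRoundoff p) = (2 : ℚ) ^ e := hE e heq
  simp only [dval] at ev
  refine ⟨l, ev, by rw [ev, hdem], ?_⟩
  rw [ex, ev, hdem]; simp only [dpoly]; ring

end Spec

end Summit.Ventures.CertifiedArithmetic.LowPrec.Opt
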